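import Mathlib
import HarnessLib
import Literature.Geometry.Lorentzian.KerrTimeDerivative
import Summits.FinalStateConjecture.FinalStateConjecture.Theses.ZeroEnergyKerrOrBomb

/-!
# Route ZeroEnergyKerrOrBomb · item `KerrModeStability` — Killing-mode pairs along the orbits of `∂_{t*}`

Helper file for item stmt-FinalStateConjecture-10024 (`KerrModeStability`). The item speaks of a
pair of real functions `(ψ, χ)` on the ingoing Kerr–Schild chart `Kerr.region a r₀` with the
eigen-relations `∂_{t*} ψ = ν ψ − ω χ`, `∂_{t*} χ = ω ψ + ν χ` on the super-level set `{r > r_p}`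
of the Kerr–Schild radius (there `r_p = r₊`). Since the radius does not depend on `t*`
(`Kerr.radius_add_time_smul_basisVector`), that set is invariant under `t*`-translations and the
relations are a linear ODE with constant coefficients along every orbit `t ↦ x + t ∂_{t*}`; this
file integrates it:

* `kerrModePair_timeShift` — `ψ(x + t∂_{t*}) = e^{νt}(cos ωt · ψ x − sin ωt · χ x)`,
  `χ(x + t∂_{t*}) = e^{νt}(sin ωt · ψ x + cos ωt · χ x)` (i.e. `Φ = ψ + iχ` satisfies
  `Φ(x + t∂_{t*}) = e^{(ν + iω)t} Φ(x)`);
* `kerrModePair_eq_zero_of_slice` — if the pair vanishes on the slice `{t* = 0} ∩ {r > r_p}` it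
  vanishes on `{r > r_p}`;
* `kerrModePair_fderiv_timeShift`, `kerrModePair_coordEnergyDensity_timeShift` — the same
  rotation law for the coordinate differentials of the extensions by zero, and the resulting exact
  law `e(x + t∂_{t*}) = e^{2νt} e(x)` for the summed coordinate energy density
  `e = ∑_μ (∂_μψ)² + (∂_μχ)²` (`coordEnergyDensity` of `WeightedNorms.lean`).

These are the elementary "separation in `t*`" facts used by every argument about the item
(Whiting 1989; Shlapentokh-Rothman, AHP 16 (2015), §1.3: mode solutions `e^{-iωt}(…)`); no new
definitions are introduced.
-/

noncomputable section

namespace Summit.FinalStateConjecture.FinalStateConjecture.Theorems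

open Literature.Geometry.Lorentzian
open scoped Manifold ContDiff Topology

-- every `Summit.FinalStateConjecture.FinalStateConjecture.…` name repeats the summit = sub-problem segment (D-0017 layout)
set_option linter.dupNamespace false

/-- `t*`-translates of a point of the chart domain `Kerr.region a r₀` stay in it (the Kerr–Schild
radius is `t*`-independent, `Kerr.radius_add_time_smul_basisVector`). -/
theorem kerr_mem_region_add_time {a r₀ : ℝ} (x : Kerr.region a r₀) (t : ℝ) :
    (x : E4) + t • E4.basisVector 0 ∈ Kerr.region a r₀ := by
  change max r₀ 0 < Kerr.radius a ((x : E4) + t • E4.basisVector 0)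
  rw [Kerr.radius_add_time_smul_basisVector]
  exact x.2

/-- **Integration of the eigen-relations along the orbits of `∂_{t*}`.** Let `ψ, χ` be smooth on
`Kerr.region a r₀` with `∂_{t*}ψ = νψ − ωχ`, `∂_{t*}χ = ωψ + νχ` at every point with `r > r_p`.
Then for every such point `x` and every `t`,
`ψ(x + t∂_{t*}) = e^{νt}(cos ωt · ψ x − sin ωt · χ x)` and
`χ(x + t∂_{t*}) = e^{νt}(sin ωt · ψ x + cos ωt · χ x)`.
Proof: along the orbit the pair solves `u' = νu − ωv`, `v' = ωu + νv`; the rotated, rescaled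
quantities `e^{-νt}(cos ωt · u + sin ωt · v)`, `e^{-νt}(−sin ωt · u + cos ωt · v)` have zero
derivative, hence are constant. -/
theorem kerrModePair_timeShift {a r₀ rp ν w : ℝ} {ψ χ : Kerr.region a r₀ → ℝ}
    (hψ : ContMDiff 𝓘(ℝ, E4) 𝓘(ℝ, ℝ) ∞ ψ) (hχ : ContMDiff 𝓘(ℝ, E4) 𝓘(ℝ, ℝ) ∞ χ)
    (heig : ∀ x : Kerr.region a r₀, rp < Kerr.radius a x.1 →
      mfderiv 𝓘(ℝ, E4) 𝓘(ℝ, ℝ) ψ x (Kerr.stationaryField a r₀ x) = ν * ψ x - w * χ x ∧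
      mfderiv 𝓘(ℝ, E4) 𝓘(ℝ, ℝ) χ x (Kerr.stationaryField a r₀ x) = w * ψ x + ν * χ x)
    (x : Kerr.region a r₀) (hx : rp < Kerr.radius a x.1) (t : ℝ) :
    ψ ⟨(x : E4) + t • E4.basisVector 0, kerr_mem_region_add_time x t⟩ =
        Real.exp (ν * t) * (Real.cos (w * t) * ψ x - Real.sin (w * t) * χ x) ∧
      χ ⟨(x : E4) + t • E4.basisVector 0, kerr_mem_region_add_time x t⟩ =
        Real.exp (ν * t) * (Real.sin (w * t) * ψ x + Real.cos (w * t) * χ x) := by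
  -- representatives
  set Φ : E4 → ℝ := Function.extend Subtype.val ψ 0 with hΦ_def
  set X : E4 → ℝ := Function.extend Subtype.val χ 0 with hX_def
  have hrepψ : ∀ y : Kerr.region a r₀, ψ y = Φ y := extend_rep ψ
  have hrepχ : ∀ y : Kerr.region a r₀, χ y = X y := extend_rep χ
  have hΦd : ∀ y : Kerr.region a r₀, DifferentiableAt ℝ Φ y := fun y ↦
    (contDiffAt_extend hψ y).differentiableAt (by simp)
  have hXd : ∀ y : Kerr.region a r₀, DifferentiableAt ℝ X y := fun y ↦
    (contDiffAt_extend hχ y).differentiableAt (by simp)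
  -- the orbit
  set γ : ℝ → E4 := fun s ↦ (x : E4) + s • E4.basisVector 0 with hγ_def
  have hγ : ∀ s, HasDerivAt γ (E4.basisVector 0) s := fun s ↦ by
    simpa [hγ_def] using ((hasDerivAt_id s).smul_const (E4.basisVector 0)).const_add (x : E4)
  have hmem : ∀ s, γ s ∈ Kerr.region a r₀ := fun s ↦ kerr_mem_region_add_time x s
  have hrad : ∀ s, rp < Kerr.radius a (γ s) := fun s ↦ by
    simp only [hγ_def, Kerr.radius_add_time_smul_basisVector]; exact hx
  -- the eigen-relations in terms of the representatives
  have hrel : ∀ s, fderiv ℝ Φ (γ s) (E4.basisVector 0) = ν * Φ (γ s) - w * X (γ s) ∧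
      fderiv ℝ X (γ s) (E4.basisVector 0) = w * Φ (γ s) + ν * X (γ s) := by
    intro s
    obtain ⟨h1, h2⟩ := heig ⟨γ s, hmem s⟩ (hrad s)
    rw [OpensChart.mfderiv_eq _ ψ Φ hrepψ (hΦd ⟨γ s, hmem s⟩)] at h1
    rw [OpensChart.mfderiv_eq _ χ X hrepχ (hXd ⟨γ s, hmem s⟩)] at h2
    rw [hrepψ ⟨γ s, hmem s⟩, hrepχ ⟨γ s, hmem s⟩] at h1 h2
    exact ⟨h1, h2⟩
  -- the pair along the orbit
  set u : ℝ → ℝ := fun s ↦ Φ (γ s) with hu_def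
  set v : ℝ → ℝ := fun s ↦ X (γ s) with hv_def
  have hu : ∀ s, HasDerivAt u (ν * u s - w * v s) s := by
    intro s
    have h := (hΦd ⟨γ s, hmem s⟩).hasFDerivAt.comp_hasDerivAt s (hγ s)
    rw [(hrel s).1] at h
    exact h
  have hv : ∀ s, HasDerivAt v (w * u s + ν * v s) s := by
    intro s
    have h := (hXd ⟨γ s, hmem s⟩).hasFDerivAt.comp_hasDerivAt s (hγ s)
    rw [(hrel s).2] at h
    exact h
  -- the integrals of motion
  set p : ℝ → ℝ := fun s ↦ Real.exp (-ν * s) * (Real.cos (w * s) * u s + Real.sin (w * s) * v s)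
    with hp_def
  set q : ℝ → ℝ := fun s ↦ Real.exp (-ν * s) * (-Real.sin (w * s) * u s + Real.cos (w * s) * v s)
    with hq_def
  have hlin : ∀ (c s : ℝ), HasDerivAt (fun s : ℝ ↦ c * s) c s := fun c s ↦
    ((hasDerivAt_id' s).const_mul c).congr_deriv (mul_one c)
  have hexp : ∀ s, HasDerivAt (fun s ↦ Real.exp (-ν * s)) (Real.exp (-ν * s) * (-ν)) s :=
    fun s ↦ (hlin (-ν) s).exp
  have hcos : ∀ s, HasDerivAt (fun s ↦ Real.cos (w * s)) (-Real.sin (w * s) * w) s :=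
    fun s ↦ (hlin w s).cos
  have hsin : ∀ s, HasDerivAt (fun s ↦ Real.sin (w * s)) (Real.cos (w * s) * w) s :=
    fun s ↦ (hlin w s).sin
  have hp : ∀ s, HasDerivAt p 0 s := by
    intro s
    have h := (hexp s).mul ((((hcos s).mul (hu s)).add ((hsin s).mul (hv s))))
    refine h.congr_deriv ?_
    simp only [Pi.mul_apply, Pi.add_apply]
    ring
  have hq : ∀ s, HasDerivAt q 0 s := by
    intro s
    have h := (hexp s).mul (((((hsin s).neg).mul (hu s)).add ((hcos s).mul (hv s))))
    refine h.congr_deriv ?_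
    simp only [Pi.mul_apply, Pi.add_apply, Pi.neg_apply]
    ring
  have hp0 : p t = p 0 :=
    is_const_of_deriv_eq_zero (fun s ↦ (hp s).differentiableAt) (fun s ↦ (hp s).deriv) t 0
  have hq0 : q t = q 0 :=
    is_const_of_deriv_eq_zero (fun s ↦ (hq s).differentiableAt) (fun s ↦ (hq s).deriv) t 0
  have hu0 : u 0 = ψ x := by
    simp only [hu_def, hγ_def, zero_smul, add_zero]
    exact (hrepψ x).symm
  have hv0 : v 0 = χ x := by
    simp only [hv_def, hγ_def, zero_smul, add_zero]
    exact (hrepχ x).symm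
  have hp0' : Real.cos (w * t) * u t + Real.sin (w * t) * v t = Real.exp (ν * t) * ψ x := by
    have h : p 0 = ψ x := by simp [hp_def, hu0]
    rw [h] at hp0
    have he : Real.exp (-ν * t) * Real.exp (ν * t) = 1 := by
      rw [← Real.exp_add]; simp
    have := congrArg (fun z ↦ Real.exp (ν * t) * z) hp0
    simp only [hp_def] at this
    calc Real.cos (w * t) * u t + Real.sin (w * t) * v t
        = (Real.exp (-ν * t) * Real.exp (ν * t)) *
            (Real.cos (w * t) * u t + Real.sin (w * t) * v t) := by rw [he, one_mul]
      _ = Real.exp (ν * t) * ψ x := by linarith [this]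
  have hq0' : -Real.sin (w * t) * u t + Real.cos (w * t) * v t = Real.exp (ν * t) * χ x := by
    have h : q 0 = χ x := by simp [hq_def, hv0]
    rw [h] at hq0
    have he : Real.exp (-ν * t) * Real.exp (ν * t) = 1 := by
      rw [← Real.exp_add]; simp
    have := congrArg (fun z ↦ Real.exp (ν * t) * z) hq0
    simp only [hq_def] at this
    calc -Real.sin (w * t) * u t + Real.cos (w * t) * v t
        = (Real.exp (-ν * t) * Real.exp (ν * t)) *
            (-Real.sin (w * t) * u t + Real.cos (w * t) * v t) := by rw [he, one_mul]
      _ = Real.exp (ν * t) * χ x := by linarith [this]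
  have hcs : Real.cos (w * t) ^ 2 + Real.sin (w * t) ^ 2 = 1 := Real.cos_sq_add_sin_sq _
  have hut : u t = Real.exp (ν * t) * (Real.cos (w * t) * ψ x - Real.sin (w * t) * χ x) := by
    linear_combination Real.cos (w * t) * hp0' - Real.sin (w * t) * hq0' - u t * hcs
  have hvt : v t = Real.exp (ν * t) * (Real.sin (w * t) * ψ x + Real.cos (w * t) * χ x) := by
    linear_combination Real.sin (w * t) * hp0' + Real.cos (w * t) * hq0' - v t * hcs
  exact ⟨(hrepψ _).trans hut, (hrepχ _).trans hvt⟩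

/-- **A Killing-mode pair which vanishes on the slice `{t* = 0} ∩ {r > r_p}` vanishes on
`{r > r_p}`**: every point `x` with `r > r_p` is the `x⁰`-translate of the slice point
`x − x⁰ ∂_{t*}` (same radius), where the pair vanishes, and `kerrModePair_timeShift` transports
the zero. -/
theorem kerrModePair_eq_zero_of_slice {a r₀ rp ν w : ℝ} {ψ χ : Kerr.region a r₀ → ℝ}
    (hψ : ContMDiff 𝓘(ℝ, E4) 𝓘(ℝ, ℝ) ∞ ψ) (hχ : ContMDiff 𝓘(ℝ, E4) 𝓘(ℝ, ℝ) ∞ χ)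
    (heig : ∀ x : Kerr.region a r₀, rp < Kerr.radius a x.1 →
      mfderiv 𝓘(ℝ, E4) 𝓘(ℝ, ℝ) ψ x (Kerr.stationaryField a r₀ x) = ν * ψ x - w * χ x ∧
      mfderiv 𝓘(ℝ, E4) 𝓘(ℝ, ℝ) χ x (Kerr.stationaryField a r₀ x) = w * ψ x + ν * χ x)
    (hzero : ∀ y : Kerr.region a r₀, rp < Kerr.radius a y.1 → (y : E4) 0 = 0 →
      ψ y = 0 ∧ χ y = 0)
    (x : Kerr.region a r₀) (hx : rp < Kerr.radius a x.1) : ψ x = 0 ∧ χ x = 0 := by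
  -- the slice point below `x`
  set t₀ : ℝ := (x : E4) 0 with ht₀
  have hmem : (x : E4) + (-t₀) • E4.basisVector 0 ∈ Kerr.region a r₀ :=
    kerr_mem_region_add_time x (-t₀)
  set y : Kerr.region a r₀ := ⟨(x : E4) + (-t₀) • E4.basisVector 0, hmem⟩ with hy
  have hyr : rp < Kerr.radius a y.1 := by
    simp only [hy, Kerr.radius_add_time_smul_basisVector]; exact hx
  have hy0 : (y : E4) 0 = 0 := by simp [hy, ht₀]
  obtain ⟨hψy, hχy⟩ := hzero y hyr hy0
  have hback : (y : E4) + t₀ • E4.basisVector 0 = x := by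
    simp only [hy]
    rw [add_assoc, ← add_smul, neg_add_cancel, zero_smul, add_zero]
  obtain ⟨h1, h2⟩ := kerrModePair_timeShift hψ hχ heig y hyr t₀
  have hx' : (⟨(y : E4) + t₀ • E4.basisVector 0, kerr_mem_region_add_time y t₀⟩ :
      Kerr.region a r₀) = x := Subtype.ext hback
  rw [hx'] at h1 h2
  rw [hψy, hχy] at h1 h2
  constructor
  · rw [h1]; ring
  · rw [h2]; ring

/-- **The rotation law for the differentials.** With `Φ, X` the extensions by zero of `ψ, χ`
(the representatives used by `coordEnergyDensity`), at every point `x` with `r > r_p` and every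
`t`: `DΦ(x + t∂_{t*}) = e^{νt}(cos ωt · DΦ(x) − sin ωt · DX(x))` and
`DX(x + t∂_{t*}) = e^{νt}(sin ωt · DΦ(x) + cos ωt · DX(x))`. Indeed the identities of
`kerrModePair_timeShift` hold on the open neighbourhood `{r > r_p}` of `x`, so they may be
differentiated (`fderiv_comp_add_right`). -/
theorem kerrModePair_fderiv_timeShift {a r₀ rp ν w : ℝ} {ψ χ : Kerr.region a r₀ → ℝ}
    (hψ : ContMDiff 𝓘(ℝ, E4) 𝓘(ℝ, ℝ) ∞ ψ) (hχ : ContMDiff 𝓘(ℝ, E4) 𝓘(ℝ, ℝ) ∞ χ)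
    (heig : ∀ x : Kerr.region a r₀, rp < Kerr.radius a x.1 →
      mfderiv 𝓘(ℝ, E4) 𝓘(ℝ, ℝ) ψ x (Kerr.stationaryField a r₀ x) = ν * ψ x - w * χ x ∧
      mfderiv 𝓘(ℝ, E4) 𝓘(ℝ, ℝ) χ x (Kerr.stationaryField a r₀ x) = w * ψ x + ν * χ x)
    (x : Kerr.region a r₀) (hx : rp < Kerr.radius a x.1) (t : ℝ) :
    fderiv ℝ (Function.extend Subtype.val ψ 0) ((x : E4) + t • E4.basisVector 0) =
        Real.exp (ν * t) • (Real.cos (w * t) • fderiv ℝ (Function.extend Subtype.val ψ 0) x -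
          Real.sin (w * t) • fderiv ℝ (Function.extend Subtype.val χ 0) x) ∧
      fderiv ℝ (Function.extend Subtype.val χ 0) ((x : E4) + t • E4.basisVector 0) =
        Real.exp (ν * t) • (Real.sin (w * t) • fderiv ℝ (Function.extend Subtype.val ψ 0) x +
          Real.cos (w * t) • fderiv ℝ (Function.extend Subtype.val χ 0) x) := by
  set Φ : E4 → ℝ := Function.extend Subtype.val ψ 0 with hΦ_def
  set X : E4 → ℝ := Function.extend Subtype.val χ 0 with hX_def
  have hrepψ : ∀ y : Kerr.region a r₀, ψ y = Φ y := extend_rep ψ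
  have hrepχ : ∀ y : Kerr.region a r₀, χ y = X y := extend_rep χ
  have hΦd : ∀ y : Kerr.region a r₀, DifferentiableAt ℝ Φ y := fun y ↦
    (contDiffAt_extend hψ y).differentiableAt (by simp)
  have hXd : ∀ y : Kerr.region a r₀, DifferentiableAt ℝ X y := fun y ↦
    (contDiffAt_extend hχ y).differentiableAt (by simp)
  -- the open set `{r > r_p} ∩ region` is a neighbourhood of `x`
  have hopen : IsOpen {z : E4 | rp < Kerr.radius a z ∧ z ∈ Kerr.region a r₀} :=
    (isOpen_lt continuous_const (Kerr.continuous_radius a)).inter (Kerr.region a r₀).isOpen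
  have hxmem : (x : E4) ∈ {z : E4 | rp < Kerr.radius a z ∧ z ∈ Kerr.region a r₀} := ⟨hx, x.2⟩
  have hnhds := hopen.mem_nhds hxmem
  -- the identities on that neighbourhood
  have hevψ : (fun z ↦ Φ (z + t • E4.basisVector 0)) =ᶠ[𝓝 (x : E4)]
      fun z ↦ Real.exp (ν * t) * (Real.cos (w * t) * Φ z - Real.sin (w * t) * X z) := by
    filter_upwards [hnhds] with z hz
    have h := (kerrModePair_timeShift hψ hχ heig ⟨z, hz.2⟩ hz.1 t).1
    rw [hrepψ, hrepψ ⟨z, hz.2⟩, hrepχ ⟨z, hz.2⟩] at h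
    exact h
  have hevχ : (fun z ↦ X (z + t • E4.basisVector 0)) =ᶠ[𝓝 (x : E4)]
      fun z ↦ Real.exp (ν * t) * (Real.sin (w * t) * Φ z + Real.cos (w * t) * X z) := by
    filter_upwards [hnhds] with z hz
    have h := (kerrModePair_timeShift hψ hχ heig ⟨z, hz.2⟩ hz.1 t).2
    rw [hrepχ, hrepψ ⟨z, hz.2⟩, hrepχ ⟨z, hz.2⟩] at h
    exact h
  have hΦx := hΦd x
  have hXx := hXd x
  constructor
  · rw [← fderiv_comp_add_right (t • E4.basisVector 0), hevψ.fderiv_eq]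
    rw [fderiv_const_mul (by fun_prop)]
    rw [fderiv_fun_sub (hΦx.const_mul _) (hXx.const_mul _), fderiv_const_mul hΦx,
      fderiv_const_mul hXx]
  · rw [← fderiv_comp_add_right (t • E4.basisVector 0), hevχ.fderiv_eq]
    rw [fderiv_const_mul (by fun_prop)]
    rw [fderiv_fun_add (hΦx.const_mul _) (hXx.const_mul _), fderiv_const_mul hΦx,
      fderiv_const_mul hXx]

/-- **Exact growth of the coordinate energy density of a Killing-mode pair**: at every point `x`
with `r > r_p` and every `t`,
`e_ψ(x + t∂_{t*}) + e_χ(x + t∂_{t*}) = e^{2νt} (e_ψ(x) + e_χ(x))`, where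
`e_f = coordEnergyDensity U f = ∑_μ (∂_μ f̃)²` (the rotation by `ωt` preserves the sum of squares).
This is the identity `|∂(e^{st*}Φ₀)|² = e^{2 Re s · t*} |…|²` behind the energy-growth contradiction
of the item. -/
theorem kerrModePair_coordEnergyDensity_timeShift {a r₀ rp ν w : ℝ}
    {ψ χ : Kerr.region a r₀ → ℝ}
    (hψ : ContMDiff 𝓘(ℝ, E4) 𝓘(ℝ, ℝ) ∞ ψ) (hχ : ContMDiff 𝓘(ℝ, E4) 𝓘(ℝ, ℝ) ∞ χ)
    (heig : ∀ x : Kerr.region a r₀, rp < Kerr.radius a x.1 →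
      mfderiv 𝓘(ℝ, E4) 𝓘(ℝ, ℝ) ψ x (Kerr.stationaryField a r₀ x) = ν * ψ x - w * χ x ∧
      mfderiv 𝓘(ℝ, E4) 𝓘(ℝ, ℝ) χ x (Kerr.stationaryField a r₀ x) = w * ψ x + ν * χ x)
    (x : Kerr.region a r₀) (hx : rp < Kerr.radius a x.1) (t : ℝ) :
    coordEnergyDensity (Kerr.region a r₀) ψ ((x : E4) + t • E4.basisVector 0) +
        coordEnergyDensity (Kerr.region a r₀) χ ((x : E4) + t • E4.basisVector 0) =
      Real.exp (2 * ν * t) *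
        (coordEnergyDensity (Kerr.region a r₀) ψ x + coordEnergyDensity (Kerr.region a r₀) χ x) := by
  obtain ⟨h1, h2⟩ := kerrModePair_fderiv_timeShift hψ hχ heig x hx t
  simp only [coordEnergyDensity, h1, h2, _root_.smul_apply, _root_.sub_apply, _root_.add_apply,
    smul_eq_mul]
  rw [← Finset.sum_add_distrib, ← Finset.sum_add_distrib, Finset.mul_sum]
  refine Finset.sum_congr rfl fun μ _ ↦ ?_
  have hcs : Real.cos (w * t) ^ 2 + Real.sin (w * t) ^ 2 = 1 := Real.cos_sq_add_sin_sq _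
  have he : Real.exp (2 * ν * t) = Real.exp (ν * t) ^ 2 := by
    rw [sq, ← Real.exp_add]; ring_nf
  rw [he]
  set A := fderiv ℝ (Function.extend Subtype.val ψ 0) x (EuclideanSpace.single μ (1 : ℝ))
  set B := fderiv ℝ (Function.extend Subtype.val χ 0) x (EuclideanSpace.single μ (1 : ℝ))
  linear_combination (Real.exp (ν * t)) ^ 2 * (A ^ 2 + B ^ 2) * hcs

end Summit.FinalStateConjecture.FinalStateConjecture.Theorems

end
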